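/-
Copyright (c) 2026 the pub-hodgecm-mathlib formalisation cell (harness21).  Prover seat hodgecm-mathlib-LH4-p15 (g2), req620 Track A «(D-RAM) FOUR-FRAME» squad
(STAGE-1b, row (2) of the piece `f_{T₊}`, the (β₂) road (R-36) «PURE-CELL LEDGER»; β₂ sub-dealer LH4-p04 (g9) WORD #21 (1) row (ROW-TERM), holder LH4-p15), 2026-09-05.
-/
import Summits.HodgeConjecture.HodgeConjecture.Theorems.F0P3cDyRamConeCellPresentation     -- ★ p862869 (LH7-p09 (g2)): the FOLD `levelSetDep_inter_shell_eq_empty_of_terminal` (over ★ p862572's per-vertex head)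
import Summits.HodgeConjecture.HodgeConjecture.Theorems.F0P3cDyRamBeta2ConesRowWindow      -- ★ p863007 (LH7-p10 (g2)): (W0) `isOrd_lam_iff_le`; brings the ‹OFF.letter› vocabulary (★ DEFS)
import HarnessLib

/-!
# Crux `H413`, line LH4 «(D-RAM) FOUR-FRAME» — STAGE-1b, row (2), the (β₂) road (R-36), lane B, row (ROW-TERM), THE `q = 2` HALF IN ‹OFF.letter.v1›'s CURRENCY —
# «AT `#𝓀[E] = 2` THE OFF-DIAGONAL TERMINAL CELL CONTRIBUTES ZERO»: `b < j`, `j + b = jl`, `2b = m`, `d % 2 = 0` ⟹ `X(j,b) = 0`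

Cell `hodgecm-mathlib` (D-0151), FLOOR 0, crux item H413 = `stmt-HodgeConjecture-24833`, route of record `HCCMUnconditional`; squad F0∕P3c∕LH4; lane
`--supports stmt-HodgeConjecture-24833 --as helper` (count-neutral; pays NO tier-0 row).  THEOREMS ONLY (no `def`, no instance, no notation, no `sorry`, default heartbeats);
★-only imports; states NO law; (β₂) stays a HYPOTHESIS.  DATUM-FREE, ONE literal, the general-block spelling of ‹OFF.letter.v1› (the binders of ★ p863420
`small2_of_term_of_dflat`'s `hterm`): `X(j,b)` := the two-finsum difference over `levelSetDep ρ Θ α (jE ϖ) h j b (lam − jE u₀₀)` cut by the two canonical label sets.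

WHY (β₂ WORD #21 (1): (ROW-TERM) = third conjunct of ‹HFT› and the `hterm` binder of ★ p863420; this seat's bus line 2026-09-05T00:31:41Z: (ROW-TERM) is taken with the cut
`b < j` — at `δ = jl − m = 0` the terminal cell is the DIAGONAL cell and is NOT zero per literal (LH4-cdis1 (g0) `ledger/LEDGERCHECK.v2` l.4∕7: keys (8,8), (10,10))).  On the
OFF-diagonal terminal line `j + b = jl`, `b < j` of the live row `2b = m`, at `#𝓀[E] = 2`, EVERY vertex over a cell member is off every `(0, m′)`-near-transvection shell — ★ p862572
`not_latticeNearTransvShell_zero_of_terminal` per vertex, folded over the cell by ★ p862869 `levelSetDep_inter_shell_eq_empty_of_terminal` (`hbj : b < j`) — so both label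
cuts of the cell are `∅` and the cell's signed count is `0 − 0`.  THIS FILE is that bookkeeping in ‹OFF›'s letters: the fold's size letters are read off `|μ| = exp(−m)`,
`|μ − ρμ| = exp(−jl)` (`μ = lam − jE u₀₀`) with `2b = m`, `j + b = jl`, `|jE ϖ| = exp(−1)`, `|α − ρα| = 1`; `lam ∈ 𝒪_j` is ★ (W0) `isOrd_lam_iff_le` (`j ≤ jl`); the `u`-letter is
`|u₀₀ − 1| ≤ |ϖ|^{m*}` with `1 ≤ m*`; the shell index `d % 2` is `0`.
* HEAD `cellDiff_terminal_eq_zero_of_card_two` — `#𝓀[E] = 2`, `d % 2 = 0`, `1 ≤ b`, `b < j`, `2b = m`, `j + b = jl` ⟹ `X(j,b) = 0`.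
WHAT IS NOT CLAIMED: the terminal cell at `#𝓀[E] ≥ 4` (a COUNT, not an emptiness: the `X`∕`T₊`∕`T₋` thirds of LH4-cdis1's (6,4)@u84), the diagonal terminal cell `δ = 0` (false per
literal), any statement at odd `d`.
HONEST LABEL.  Count-neutral lattice bookkeeping; nothing printed is asserted; no census law is stated; (ROW-TERM) at `q ≥ 4`, ‹HFT›, ‹SMALL-2›, ‹CORE› stay OPEN; `HC_CM` is proved
only modulo the 7 printed citations (2 remaining named inputs: hLiu418 = `stmt-HodgeConjecture-24832`, h413 = `stmt-HodgeConjecture-24833`) until rung 0 closes.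
## References
* [Kottwitz1986BaseChangeUnits] R. E. Kottwitz, *Base change for unit elements of Hecke algebras*, Compositio Math. 60 (1986): §1 pp. 240–241, §3 (signed fixed-lattice counts).
* [Rogawski1990] J. D. Rogawski, *Automorphic Representations of Unitary Groups in Three Variables*, Ann. of Math. Stud. 123 (1990): §4.9 Prop. 4.9.1 (b) p. 55.
* [Jacobowitz1962] R. Jacobowitz, *Hermitian forms over local fields*, Amer. J. Math. 84 (1962): §4 (dual lattices, gluing).
* [Serre1979] J.-P. Serre, *Local Fields*, GTM 67 (1979): Ch. III §6 Prop. 12 (orders of conductor `ϖ^j`).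
-/

set_option autoImplicit false

noncomputable section

namespace Summit.HodgeConjecture.HodgeConjecture.Cruxes.H413.F0P3cDyRamTerminalCellCardTwoZero

open scoped Matrix MatrixGroups Classical Valued WithZero
open WithZero
open Literature.NumberTheory.Automorphic Literature.NumberTheory.Automorphic.UnitaryThreeFourFrame Literature.NumberTheory.Automorphic.UnitaryLatticeTree
open Literature.NumberTheory.Automorphic.HermitianLattice Literature.NumberTheory.Automorphic.EllipticPlaneAsFieldLine Literature.NumberTheory.LocalFields.QuadraticOrder
open Literature.NumberTheory.Rogawski1990
open Summit.HodgeConjecture.HodgeConjecture.Cruxes.H413.F0P3cDyRamToricCensusDefs Summit.HodgeConjecture.HodgeConjecture.Cruxes.H413.F0P3cDyRamFourFramePieces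
open Summit.HodgeConjecture.HodgeConjecture.Cruxes.H413.F0P3cDyRamFourFrameCensusDefs Summit.HodgeConjecture.HodgeConjecture.Cruxes.H413.F0P3cDyRamStageOneBDefs
open Summit.HodgeConjecture.HodgeConjecture.Cruxes.H413
open Summit.HodgeConjecture.HodgeConjecture.Cruxes.H413.F0P3cDyRamConeCellPresentation (levelSetDep_inter_shell_eq_empty_of_terminal)
open Summit.HodgeConjecture.HodgeConjecture.Cruxes.H413.F0P3cDyRamBeta2ConesRowWindow (isOrd_lam_iff_le)

variable {E M : Type} [Field E] [Valued E ℤᵐ⁰] [Field M] [Valued M ℤᵐ⁰]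
  {σ : E →+* E} {ϖ : E} {d tE : ℕ} {jE : E →+* M} {ρ Θ : M →+* M} {α lam : M} {γ₂ : GL (Fin 2) E} {u : GL (Fin 1) E} {m jl : ℕ}
  {H₂ : Matrix (Fin 2) (Fin 2) E} {hW : E} {φ : (Fin 2 → E) →+ M} {h : M} {f : ℕ → ℕ → AddSubgroup M → ℕ}

/-- **HEAD — «AT `#𝓀[E] = 2` THE OFF-DIAGONAL TERMINAL CELL CONTRIBUTES ZERO».**  ‹OFF.letter.v1›'s general-block letters (E-side wild datum `IsRamifiedQuadraticDatum σ ϖ d tE`,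
finite residue field with `Nat.card 𝓀[E] = 2`; block frame `(H₂, h_W)`, `Γ = endoGL (γ₂, u)`; line model `(M, jE, ρ, Θ, α; φ, lam, h)` with `|α − ρα| = 1`, `|jE a| = |a|`,
`hEval`, `hϖmax`, `hjpow`; depths `|lam − jE u₀₀| = exp(−m)`, `|(lam − jE u₀₀) − ρ(lam − jE u₀₀)| = exp(−jl)`; `|u₀₀ − 1| ≤ |ϖ|^{m*}`), and the cell letters `d % 2 = 0`, `1 ≤ b`,
`b < j`, `2b = m`, `j + b = jl`.  THEN `X(j,b) = 0`: both label cuts of `levelSetDep(j, b; lam − jE u₀₀)` are EMPTY (★ p862869 `levelSetDep_inter_shell_eq_empty_of_terminal` at the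
shells `(0, m*)` and `(0, m_c)`), so the two finsums vanish. [cite: Kottwitz1986BaseChangeUnits, §1 pp. 240–241; §3] [cite: Rogawski1990, §4.9 Prop. 4.9.1 (b) p. 55] -/
theorem cellDiff_terminal_eq_zero_of_card_two [Finite 𝓀[E]] (hq2 : Nat.card 𝓀[E] = 2)
    (hD : IsRamifiedQuadraticDatum σ ϖ d tE) (hd2 : d % 2 = 0)
    (hH₂ : IsUnit H₂.det) (hH₂σ : (H₂.map σ)ᵀ = H₂) (hhW : Valued.v hW = 1)
    (hρρ : ∀ z, ρ (ρ z) = z) (hvρ : ∀ z, Valued.v (ρ z) = Valued.v z) (hρj : ∀ a, ρ (jE a) = jE a) (hα : ρ α ≠ α) (hα1 : Valued.v α ≤ 1)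
    (hint : ∀ z : M, Valued.v z ≤ 1 → Valued.v ((z - ρ z) / (α - ρ α)) ≤ 1)
    (hΘΘ : ∀ z, Θ (Θ z) = z) (hΘρ : ∀ z, Θ (ρ z) = ρ (Θ z)) (hvΘ : ∀ z, Valued.v (Θ z) = Valued.v z)
    (hjv : ∀ a, Valued.v (jE a) ≤ 1 ↔ Valued.v a ≤ 1) (hjfix : ∀ z : M, ρ z = z ↔ ∃ a, jE a = z)
    (hjpow : ∀ (t : E) (n : ℤ), Valued.v (jE t) = Valued.v (jE ϖ) ^ n ↔ Valued.v t = Valued.v ϖ ^ n)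
    (hEval : ∀ c : M, ρ c = c → c ≠ 0 → Valued.v c ≤ 1 → ∃ n : ℕ, Valued.v c = Valued.v (jE ϖ) ^ n)
    (hϖmax : ∀ t : M, ρ t = t → Valued.v t < 1 → Valued.v t ≤ Valued.v (jE ϖ)) (hjiso : ∀ a, Valued.v (jE a) = Valued.v a) (hU : Valued.v (α - ρ α) = 1)
    (hφs : ∀ (c : E) (x : Fin 2 → E), φ (c • x) = jE c * φ x) (hφi : Function.Injective φ) (hφo : Function.Surjective φ)
    (hφγ : ∀ x, φ ((γ₂ : Matrix (Fin 2) (Fin 2) E).mulVec x) = lam * φ x) (hvlam : Valued.v lam = 1)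
    (hΘh : Θ h = h) (hh : h ≠ 0) (hform : ∀ x y, jE (pairing σ H₂ x y) = h * Θ (φ x) * φ y + ρ (h * Θ (φ x) * φ y))
    (hm : Valued.v (lam - jE ((u : Matrix (Fin 1) (Fin 1) E) 0 0)) = WithZero.exp (-(m : ℤ)))
    (hjl : Valued.v ((lam - jE ((u : Matrix (Fin 1) (Fin 1) E) 0 0)) - ρ (lam - jE ((u : Matrix (Fin 1) (Fin 1) E) 0 0))) = WithZero.exp (-(jl : ℤ)))
    (hum : Valued.v (((u : Matrix (Fin 1) (Fin 1) E) 0 0) - 1) ≤ Valued.v (ϖ ^ mstarOfRecord d))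
    {b j : ℕ} (hb1 : 1 ≤ b) (hbj : b < j) (hbm : 2 * b = m) (hjb : j + b = jl) :
    ((∑ᶠ Λ ∈ levelSetDep ρ Θ α (jE ϖ) h j b (lam - jE ((u : Matrix (Fin 1) (Fin 1) E) 0 0)) ∩
                      {Λ | ∃ B : Submodule 𝒪[E] (Fin 2 → E), B.toAddSubgroup.map φ = Λ ∧
                        ∃ L₃ : Submodule 𝒪[E] (Fin 3 → E), IsSelfDualLattice σ ϖ (!![H₂ 0 0, 0, H₂ 0 1; 0, hW, 0; H₂ 1 0, 0, H₂ 1 1] : Matrix (Fin 3) (Fin 3) E) L₃ ∧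
                          L₃ ⊓ LinearMap.ker ((LinearMap.proj (1 : Fin 3) : (Fin 3 → E) →ₗ[E] E).restrictScalars 𝒪[E]) =
                            B.map ((Matrix.toLin' (!![1, 0; 0, 0; 0, 1] : Matrix (Fin 3) (Fin 2) E)).restrictScalars 𝒪[E]) ∧
                          (∀ c : E, (Pi.single 1 c : Fin 3 → E) ∈ L₃ ↔ Valued.v c ≤ Valued.v ϖ ^ b) ∧
                          (LatticeNearTransvShell ϖ (d % 2) (mstarOfRecord d) ((((endoGL (γ₂, u) : GL (Fin 3) E) : Matrix (Fin 3) (Fin 3) E) - 1)) L₃ ∧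
                            {z : E | ∃ y ∈ L₃, Valued.v ((ϖ ^ (mstarOfRecord d))⁻¹ * (z - pairing σ (!![H₂ 0 0, 0, H₂ 0 1; 0, hW, 0; H₂ 1 0, 0, H₂ 1 1] : Matrix (Fin 3) (Fin 3) E) y (((((endoGL (γ₂, u) : GL (Fin 3) E) : Matrix (Fin 3) (Fin 3) E) - 1)) *ᵥ y))) ≤ 1} =
                              valueSetMod σ ϖ (mstarOfRecord d) (xPlus σ ϖ d))}, f b j Λ : ℕ) : ℤ) -
                  ((∑ᶠ Λ ∈ levelSetDep ρ Θ α (jE ϖ) h j b (lam - jE ((u : Matrix (Fin 1) (Fin 1) E) 0 0)) ∩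
                      {Λ | ∃ B : Submodule 𝒪[E] (Fin 2 → E), B.toAddSubgroup.map φ = Λ ∧
                        ∃ L₃ : Submodule 𝒪[E] (Fin 3 → E), IsSelfDualLattice σ ϖ (!![H₂ 0 0, 0, H₂ 0 1; 0, hW, 0; H₂ 1 0, 0, H₂ 1 1] : Matrix (Fin 3) (Fin 3) E) L₃ ∧
                          L₃ ⊓ LinearMap.ker ((LinearMap.proj (1 : Fin 3) : (Fin 3 → E) →ₗ[E] E).restrictScalars 𝒪[E]) =
                            B.map ((Matrix.toLin' (!![1, 0; 0, 0; 0, 1] : Matrix (Fin 3) (Fin 2) E)).restrictScalars 𝒪[E]) ∧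
                          (∀ c : E, (Pi.single 1 c : Fin 3 → E) ∈ L₃ ↔ Valued.v c ≤ Valued.v ϖ ^ b) ∧
                          (LatticeNearTransvShell ϖ (d % 2) (mcOfRecord d) ((((endoGL (γ₂, u) : GL (Fin 3) E) : Matrix (Fin 3) (Fin 3) E) - 1)) L₃ ∧
                            ¬ {z : E | ∃ y ∈ L₃, Valued.v ((ϖ ^ (mstarOfRecord d))⁻¹ * (z - pairing σ (!![H₂ 0 0, 0, H₂ 0 1; 0, hW, 0; H₂ 1 0, 0, H₂ 1 1] : Matrix (Fin 3) (Fin 3) E) y (((((endoGL (γ₂, u) : GL (Fin 3) E) : Matrix (Fin 3) (Fin 3) E) - 1)) *ᵥ y))) ≤ 1} =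
                              valueSetMod σ ϖ (mstarOfRecord d) (xPlus σ ϖ d))}, f b j Λ : ℕ) : ℤ) = 0 := by
  -- the residue field as a `Fintype` of cardinality `2`
  haveI : Fintype 𝓀[E] := Fintype.ofFinite 𝓀[E]
  have hq : Fintype.card 𝓀[E] = 2 := by rw [← Nat.card_eq_fintype_card]; exact hq2
  -- letters of the E-side datum
  obtain ⟨hσ, hvσ, hϖ, -, -, h1d, -⟩ := id hD
  have hqM : Valued.v (jE ϖ) = exp (-1 : ℤ) := by rw [hjiso, hϖ]
  have hqpow : ∀ n : ℕ, Valued.v (jE ϖ) ^ n = exp (-(n : ℤ)) := fun n => by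
    rw [hqM, ← exp_nsmul, nsmul_eq_mul, mul_neg, mul_one]
  -- `lam ∈ 𝒪_j` (`j ≤ jl`), the `u`-letter at `m′ = m*` (`1 ≤ m*`)
  have hlamj : IsOrd ρ α (jE ϖ ^ j) lam := (isOrd_lam_iff_le (u := u) hD hρj hvlam hU hjiso hjl j).2 (by omega)
  have hm1 : 1 ≤ mstarOfRecord d := by unfold mstarOfRecord; omega
  -- the TERMINAL size letters: `|μ| = |jEϖ|^{2b}` (the row) and `|μ − ρμ| = |jEϖ^j(α − ρα)|·|jEϖ|^b` (`j + b = jl`)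
  have hμ : Valued.v (lam - jE ((u : Matrix (Fin 1) (Fin 1) E) 0 0)) = Valued.v (jE ϖ) ^ (2 * b) := by
    rw [hm, hqpow]; congr 2; push_cast; omega
  have hanti : Valued.v ((lam - jE ((u : Matrix (Fin 1) (Fin 1) E) 0 0)) - ρ (lam - jE ((u : Matrix (Fin 1) (Fin 1) E) 0 0))) =
      Valued.v (jE ϖ ^ j * (α - ρ α)) * Valued.v (jE ϖ) ^ b := by
    rw [hjl, map_mul, hU, mul_one, map_pow, hqpow, hqpow, ← exp_add]; congr 1; omega
  -- the shell index `d % 2 = 0`; both label cuts are `∅`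
  simp only [hd2]
  rw [levelSetDep_inter_shell_eq_empty_of_terminal hq σ hσ hvσ hϖ hH₂ hH₂σ hhW jE hρρ hvρ hα hα1 hint hΘΘ hΘρ hvΘ hjv hjfix hjpow hEval hϖmax φ hφs hφi hφo
      hφγ hvlam hΘh hh hform u hm1 hum hb1 hbj hlamj hμ hanti (mstarOfRecord d) _,
    levelSetDep_inter_shell_eq_empty_of_terminal hq σ hσ hvσ hϖ hH₂ hH₂σ hhW jE hρρ hvρ hα hα1 hint hΘΘ hΘρ hvΘ hjv hjfix hjpow hEval hϖmax φ hφs hφi hφo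
      hφγ hvlam hΘh hh hform u hm1 hum hb1 hbj hlamj hμ hanti (mcOfRecord d) _, finsum_mem_empty]
  simp

end Summit.HodgeConjecture.HodgeConjecture.Cruxes.H413.F0P3cDyRamTerminalCellCardTwoZero

end
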